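import Summits.ResolutionOfSingularities.ResolutionOfSingularities.Theorems.FrobeniusLadderFInjectiveMacaulayficationAffineBlowupChartRestriction
import HarnessLib

/-!
# [OURS · L1 W4.5a] E7 R3 (generic half, part 2) `AffineBlowupChartRestrictionUnits` — the restriction lemma with memberships UP TO
# POWERS OF THE CHART UNITS (the cert's `denominator_exps`)

Crux `FrobeniusLadder.FInjectiveMacaulayfication` = stmt-ResolutionOfSingularities-15315 (chain w45a), hole 5e, E7 instance layer
(res-L1-w45a-plan-1 R12.60 (4) / R13.13 (4): «034 := R3»). Companion of `AffineBlowupChartRestriction` (p532056): there the restriction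
lemma `map_primeIdealOf_eq_of_memberships` asks, for each generator `x′_j/(bt)^{m_j}` of the candidate prime `P ⊆ R[I/b]`, the membership
`x′_j/(at)^{m_j} ∈ 𝔭_ξ·e_a` on the defining chart, and symmetrically. In tri-1's certificate `cert-T11-p3-tower.v1.json`
(`restriction_certificates.memberships`) a generator is pulled back to the other chart only AFTER CLEARING A MONOMIAL DENOMINATOR
(`q · m^e = Σ aᵢ pᵢ`, fields `pulled_numerator` / `denominator_exps` / `cofactors`). In numerator form that is: the numerator `x′_j`
times a POWER OF THE CHART ELEMENT `(bt)` (resp. `(at)`) has the membership. Since `ξ` — and the generic point `η` of `P`, which lies in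
both charts — is in `D₊(at) ∩ D₊(bt)`, its homogeneous prime contains neither `at` nor `bt`, so these factors cancel
(`mul_reesT_pow_mem_iff`), and the restriction lemma holds with the weaker memberships: `map_primeIdealOf_eq_of_memberships'`,
ideal-sheaf form `map_ideal_closure_eq_of_memberships'` (the `hJ` guard of `AffineBlowupChartTransport.chartClause_transport` on a chart
meeting the bad curve). Helper `--supports stmt-ResolutionOfSingularities-15315 --as helper`, typed by res-type-034. OURS: replaces the
role of NOTHING in H. Hironaka's manuscript and is NOT a statement of it; AI-written kernel glue of the cell `res-hironaka`, weaker than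
expert review. No definition, no named fact. References: The Stacks Project, Tag 0804 — background; folklore.
-/

-- single-problem summit: the doubled namespace component is forced
set_option linter.dupNamespace false

noncomputable section

open AlgebraicGeometry CategoryTheory TopologicalSpace HomogeneousLocalization
open Literature.AlgebraicGeometry.Resolution
open Summit.ResolutionOfSingularities.ResolutionOfSingularities.Theorems.FInjectiveMacaulayfication
open Summit.ResolutionOfSingularities.ResolutionOfSingularities.Theorems.FInjectiveMacaulayfication.AffineBlowupChartRestriction

namespace Summit.ResolutionOfSingularities.ResolutionOfSingularities.Theorems.FInjectiveMacaulayfication.AffineBlowupChartRestrictionUnits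

section ReesUnits

universe u

variable {R : Type u} [CommRing R] {I : Ideal R} {a b : R} {ha : a ∈ I} {hb : b ∈ I}

/-- `x · (bt)ᴺ` is homogeneous of degree `n + N` when `x` is homogeneous of degree `n`. [folklore] -/
theorem mul_reesT_pow_mem_reesGrading {n : ℕ} {x : reesAlgebra I} (hx : x ∈ reesGrading I (n • 1)) (N : ℕ) :
    x * reesT b hb ^ N ∈ reesGrading I ((n + N) • 1) := by
  rw [add_nsmul]
  exact SetLike.mul_mem_graded hx (SetLike.pow_mem_graded N (reesT_mem b hb))

/-- **Cancelling the chart unit in a point's homogeneous prime**: for `y ∈ D₊(bt)`, `x · (bt)ᴺ ∈ y ↔ x ∈ y`. [folklore] -/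
theorem mul_reesT_pow_mem_iff (y : ↥(affineBlowup I)) (hy : y ∈ Proj.basicOpen (reesGrading I) (reesT b hb))
    (x : reesAlgebra I) (N : ℕ) :
    x * reesT b hb ^ N ∈ y.asHomogeneousIdeal ↔ x ∈ y.asHomogeneousIdeal := by
  rw [Proj.mem_basicOpen] at hy
  refine ⟨fun h => ?_, fun h => Ideal.mul_mem_right _ _ h⟩
  rcases y.isPrime.mem_or_mem (show x * reesT b hb ^ N ∈ y.asHomogeneousIdeal.toIdeal from h) with hx | hN
  · exact hx
  · exact absurd (y.isPrime.mem_of_pow_mem N hN) hy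

/-- **THE RESTRICTION LEMMA, memberships up to chart units.** As `map_primeIdealOf_eq_of_memberships`, but (h1′): for each
generator `x′_j/(bt)^{m_j}` of `P`, `x′_j·(bt)^{N′_j} / (at)^{m_j+N′_j} ∈ 𝔭_ξ·e_a`; (h2′): for each generator `x_i/(at)^{n_i}` of
`𝔭_ξ·e_a`, `x_i·(at)^{N_i} / (bt)^{n_i+N_i} ∈ P` — i.e. the cert's identities `q · m^e = Σ aᵢ pᵢ` with their `denominator_exps`, each a
membership in ONE chart ring. Conclusion `𝔭_ξ·e_b = P`. [folklore] -/
theorem map_primeIdealOf_eq_of_memberships'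
    (ea : Γ(affineBlowup I, Proj.basicOpen (reesGrading I) (reesT a ha)) ≃+* blowupAlgebra I a)
    (hea : ∀ g : Away (reesGrading I) (reesT a ha),
      ea ((Proj.basicOpenIsoAway (reesGrading I) (reesT a ha) (reesT_mem a ha) Nat.one_pos).hom g) = reesChartEquiv a ha g)
    (eb : Γ(affineBlowup I, Proj.basicOpen (reesGrading I) (reesT b hb)) ≃+* blowupAlgebra I b)
    (heb : ∀ g : Away (reesGrading I) (reesT b hb),
      eb ((Proj.basicOpenIsoAway (reesGrading I) (reesT b hb) (reesT_mem b hb) Nat.one_pos).hom g) = reesChartEquiv b hb g)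
    (ξ : ↥(affineBlowup I)) (hξa : ξ ∈ Proj.basicOpen (reesGrading I) (reesT a ha))
    (hξb : ξ ∈ Proj.basicOpen (reesGrading I) (reesT b hb))
    {k : ℕ} (n : Fin k → ℕ) (x : Fin k → reesAlgebra I) (hx : ∀ i, x i ∈ reesGrading I (n i • 1))
    (hQa : ((⟨Proj.basicOpen (reesGrading I) (reesT a ha), AffineBlowupChartFrame.isAffineOpen_basicOpen_reesT I a ha⟩ :
          (affineBlowup I).affineOpens).2.primeIdealOf ⟨ξ, hξa⟩).asIdeal.map ea ≤
      Ideal.span (Set.range fun i : Fin k =>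
        reesChartEquiv a ha (HomogeneousLocalization.Away.mk (reesGrading I) (reesT_mem a ha) (n i) (x i) (hx i))))
    (P : Ideal (blowupAlgebra I b)) [P.IsPrime]
    (haP : (⟨algebraMap R (Localization.Away b) a * IsLocalization.Away.invSelf b, div_mem_blowupAlgebra I b ha⟩ :
      blowupAlgebra I b) ∉ P)
    {l : ℕ} (m : Fin l → ℕ) (x' : Fin l → reesAlgebra I) (hx' : ∀ j, x' j ∈ reesGrading I (m j • 1))
    (hP : P ≤ Ideal.span (Set.range fun j : Fin l =>
      reesChartEquiv b hb (HomogeneousLocalization.Away.mk (reesGrading I) (reesT_mem b hb) (m j) (x' j) (hx' j))))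
    -- the memberships, up to powers of the chart units
    (N' : Fin l → ℕ)
    (h1 : ∀ j : Fin l, reesChartEquiv a ha (HomogeneousLocalization.Away.mk (reesGrading I) (reesT_mem a ha) (m j + N' j)
        (x' j * reesT b hb ^ N' j) (mul_reesT_pow_mem_reesGrading (hx' j) (N' j))) ∈
      ((⟨Proj.basicOpen (reesGrading I) (reesT a ha), AffineBlowupChartFrame.isAffineOpen_basicOpen_reesT I a ha⟩ :
          (affineBlowup I).affineOpens).2.primeIdealOf ⟨ξ, hξa⟩).asIdeal.map ea)
    (N : Fin k → ℕ)
    (h2 : ∀ i : Fin k, reesChartEquiv b hb (HomogeneousLocalization.Away.mk (reesGrading I) (reesT_mem b hb) (n i + N i)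
        (x i * reesT a ha ^ N i) (mul_reesT_pow_mem_reesGrading (hx i) (N i))) ∈ P) :
    ((⟨Proj.basicOpen (reesGrading I) (reesT b hb), AffineBlowupChartFrame.isAffineOpen_basicOpen_reesT I b hb⟩ :
        (affineBlowup I).affineOpens).2.primeIdealOf ⟨ξ, hξb⟩).asIdeal.map eb = P := by
  set Ua : (affineBlowup I).affineOpens :=
    ⟨Proj.basicOpen (reesGrading I) (reesT a ha), AffineBlowupChartFrame.isAffineOpen_basicOpen_reesT I a ha⟩ with hUa
  set Ub : (affineBlowup I).affineOpens :=
    ⟨Proj.basicOpen (reesGrading I) (reesT b hb), AffineBlowupChartFrame.isAffineOpen_basicOpen_reesT I b hb⟩ with hUb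
  apply le_antisymm
  · -- `𝔭_ξ·e_b ≤ P`: through the generic point `η` of `P`
    obtain ⟨η, hηb, hη⟩ := exists_map_primeIdealOf_eq Ub eb ⟨P, inferInstance⟩
    change (Ub.2.primeIdealOf ⟨η, hηb⟩).asIdeal.map eb = P at hη
    have hηa : η ∈ Proj.basicOpen (reesGrading I) (reesT a ha) := by
      refine (AffineBlowupChartTransport.mem_basicOpen_symm_div_iff eb heb a ha η hηb).mp ?_
      by_contra hD
      apply haP
      rw [← hη, ← Ideal.symm_apply_mem_of_equiv_iff]
      exact (AffineBlowupChartTransport.mem_primeIdealOf_iff_not_mem_basicOpen Ub hηb _).mpr hD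
    have hcl : η ∈ closure ({ξ} : Set ↥(affineBlowup I)) := by
      rw [← IdealSheafOfPointClosure.primeIdealOf_le_iff_mem_closure Ua ξ hξa η hηa,
        ← AffineBlowupChartTransport.map_le_map_iff_of_ringEquiv ea]
      refine hQa.trans ?_
      rw [Ideal.span_le]
      rintro _ ⟨i, rfl⟩
      -- `x_i·(at)^{N_i}/(bt)^{n_i+N_i} ∈ P = 𝔭_η·e_b` ⇒ `x_i·(at)^{N_i} ∈ η` ⇒ `x_i ∈ η` ⇒ `x_i/(at)^{n_i} ∈ 𝔭_η·e_a`
      have hib : eb.symm (reesChartEquiv b hb (HomogeneousLocalization.Away.mk (reesGrading I) (reesT_mem b hb) (n i + N i)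
          (x i * reesT a ha ^ N i) (mul_reesT_pow_mem_reesGrading (hx i) (N i)))) ∈ (Ub.2.primeIdealOf ⟨η, hηb⟩).asIdeal := by
        rw [Ideal.symm_apply_mem_of_equiv_iff, hη]
        exact h2 i
      have hxη : x i ∈ η.asHomogeneousIdeal :=
        (mul_reesT_pow_mem_iff η hηa (x i) (N i)).mp
          ((AffineBlowupChartTransport.symm_mk_mem_primeIdealOf_iff eb heb η hηb (n i + N i) _ _).mp hib)
      exact Ideal.symm_apply_mem_of_equiv_iff.mp
        ((AffineBlowupChartTransport.symm_mk_mem_primeIdealOf_iff ea hea η hηa (n i) (x i) (hx i)).mpr hxη)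
    have hle : (Ub.2.primeIdealOf ⟨ξ, hξb⟩).asIdeal ≤ (Ub.2.primeIdealOf ⟨η, hηb⟩).asIdeal :=
      (IdealSheafOfPointClosure.primeIdealOf_le_iff_mem_closure Ub ξ hξb η hηb).mpr hcl
    rw [← hη]
    exact Ideal.map_mono hle
  · -- `P ≤ 𝔭_ξ·e_b`: `x′_j·(bt)^{N′_j} ∈ ξ`, hence `x′_j ∈ ξ`
    refine hP.trans ?_
    rw [Ideal.span_le]
    rintro _ ⟨j, rfl⟩
    have hja : ea.symm (reesChartEquiv a ha (HomogeneousLocalization.Away.mk (reesGrading I) (reesT_mem a ha) (m j + N' j)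
        (x' j * reesT b hb ^ N' j) (mul_reesT_pow_mem_reesGrading (hx' j) (N' j)))) ∈ (Ua.2.primeIdealOf ⟨ξ, hξa⟩).asIdeal :=
      Ideal.symm_apply_mem_of_equiv_iff.mpr (h1 j)
    have hxξ : x' j ∈ ξ.asHomogeneousIdeal :=
      (mul_reesT_pow_mem_iff ξ hξb (x' j) (N' j)).mp
        ((AffineBlowupChartTransport.symm_mk_mem_primeIdealOf_iff ea hea ξ hξa (m j + N' j) _ _).mp hja)
    exact Ideal.symm_apply_mem_of_equiv_iff.mp
      ((AffineBlowupChartTransport.symm_mk_mem_primeIdealOf_iff eb heb ξ hξb (m j) (x' j) (hx' j)).mpr hxξ)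

/-- Ideal-sheaf form: `(𝓘(closure {ξ}).ideal D₊(bt))·e_b = P` from the unit-tolerant memberships. [folklore] -/
theorem map_ideal_closure_eq_of_memberships'
    (ea : Γ(affineBlowup I, Proj.basicOpen (reesGrading I) (reesT a ha)) ≃+* blowupAlgebra I a)
    (hea : ∀ g : Away (reesGrading I) (reesT a ha),
      ea ((Proj.basicOpenIsoAway (reesGrading I) (reesT a ha) (reesT_mem a ha) Nat.one_pos).hom g) = reesChartEquiv a ha g)
    (eb : Γ(affineBlowup I, Proj.basicOpen (reesGrading I) (reesT b hb)) ≃+* blowupAlgebra I b)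
    (heb : ∀ g : Away (reesGrading I) (reesT b hb),
      eb ((Proj.basicOpenIsoAway (reesGrading I) (reesT b hb) (reesT_mem b hb) Nat.one_pos).hom g) = reesChartEquiv b hb g)
    (ξ : ↥(affineBlowup I)) (hξa : ξ ∈ Proj.basicOpen (reesGrading I) (reesT a ha))
    (hξb : ξ ∈ Proj.basicOpen (reesGrading I) (reesT b hb))
    {k : ℕ} (n : Fin k → ℕ) (x : Fin k → reesAlgebra I) (hx : ∀ i, x i ∈ reesGrading I (n i • 1))
    (hQa : ((⟨Proj.basicOpen (reesGrading I) (reesT a ha), AffineBlowupChartFrame.isAffineOpen_basicOpen_reesT I a ha⟩ :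
          (affineBlowup I).affineOpens).2.primeIdealOf ⟨ξ, hξa⟩).asIdeal.map ea ≤
      Ideal.span (Set.range fun i : Fin k =>
        reesChartEquiv a ha (HomogeneousLocalization.Away.mk (reesGrading I) (reesT_mem a ha) (n i) (x i) (hx i))))
    (P : Ideal (blowupAlgebra I b)) [P.IsPrime]
    (haP : (⟨algebraMap R (Localization.Away b) a * IsLocalization.Away.invSelf b, div_mem_blowupAlgebra I b ha⟩ :
      blowupAlgebra I b) ∉ P)
    {l : ℕ} (m : Fin l → ℕ) (x' : Fin l → reesAlgebra I) (hx' : ∀ j, x' j ∈ reesGrading I (m j • 1))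
    (hP : P ≤ Ideal.span (Set.range fun j : Fin l =>
      reesChartEquiv b hb (HomogeneousLocalization.Away.mk (reesGrading I) (reesT_mem b hb) (m j) (x' j) (hx' j))))
    (N' : Fin l → ℕ)
    (h1 : ∀ j : Fin l, reesChartEquiv a ha (HomogeneousLocalization.Away.mk (reesGrading I) (reesT_mem a ha) (m j + N' j)
        (x' j * reesT b hb ^ N' j) (mul_reesT_pow_mem_reesGrading (hx' j) (N' j))) ∈
      ((⟨Proj.basicOpen (reesGrading I) (reesT a ha), AffineBlowupChartFrame.isAffineOpen_basicOpen_reesT I a ha⟩ :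
          (affineBlowup I).affineOpens).2.primeIdealOf ⟨ξ, hξa⟩).asIdeal.map ea)
    (N : Fin k → ℕ)
    (h2 : ∀ i : Fin k, reesChartEquiv b hb (HomogeneousLocalization.Away.mk (reesGrading I) (reesT_mem b hb) (n i + N i)
        (x i * reesT a ha ^ N i) (mul_reesT_pow_mem_reesGrading (hx i) (N i))) ∈ P) :
    ((Scheme.IdealSheafData.vanishingIdeal (⟨closure ({ξ} : Set ↥(affineBlowup I)), isClosed_closure⟩ :
        Closeds ↥(affineBlowup I))).ideal
      ⟨Proj.basicOpen (reesGrading I) (reesT b hb), AffineBlowupChartFrame.isAffineOpen_basicOpen_reesT I b hb⟩).map eb = P := by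
  rw [IdealSheafOfPointClosure.ideal_eq_primeIdealOf ξ
    ⟨Proj.basicOpen (reesGrading I) (reesT b hb), AffineBlowupChartFrame.isAffineOpen_basicOpen_reesT I b hb⟩ hξb]
  exact map_primeIdealOf_eq_of_memberships' ea hea eb heb ξ hξa hξb n x hx hQa P haP m x' hx' hP N' h1 N h2

end ReesUnits

end Summit.ResolutionOfSingularities.ResolutionOfSingularities.Theorems.FInjectiveMacaulayfication.AffineBlowupChartRestrictionUnits

end
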